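import Literature.Topology.FourManifolds.CircleSurgeryExistence
import HarnessLib

/-!
# The swap of a toral shell: exchanging the two circles and reparametrising the radius

Topic `Literature/Topology/FourManifolds`; model geometry for the construction of the cobordism
`X = M × I - (L × D² × I) ∪ ∐ᵢ (S³ × I - Cᵢ × D²)` of Akbulut–Ruberman (2016), Lemma 2.3, "where we
glue the longitudes of each `Kᵢ` to the respective meridian of `Lᵢ` and vice versa" (fact seat
of `Literature.Barriers.SmoothPoincare4.akbulutRuberman2016_symmetryKillingCobordism`). The open
toral shell `𝕊 1 × {w ∣ t₀ < ‖w‖ < t₁}` of the open solid torus `𝕊 1 × ℝ²` is, through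
`(u, w) ↦ (u, w/‖w‖, ‖w‖)`, the thickened torus `𝕊 1 × 𝕊 1 × (t₀, t₁)`; the **shell swap**
exchanges the two circle factors (longitude `u` ↔ meridian `w/‖w‖`) and reparametrises the
radius by a diffeomorphism `n : (t₀, t₁) ≅ (r₀, r₁)` (inverse `m`):

`swap (u, w) = (w/‖w‖, n(‖w‖) • u) : 𝕊 1 × ℝ² ⊇ shell(t₀, t₁) ≅ shell(r₀, r₁) ⊆ 𝕊 1 × ℝ²`,

with inverse the swap `(x, w′) ↦ (w′/‖w′‖, m(‖w′‖) • x)` of the same shape. This is the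
coordinate change by which the shell around a component `Lᵢ` of the link (read in a
solid-torus chart of `M`) is glued to the normal shell of the concordance annulus `Cᵢ` (read in
its framed tube): `u` (along `Lᵢ`) becomes the normal angle of `Cᵢ` (its meridian) and
`w/‖w‖` (meridian of `Lᵢ`) becomes the annulus circle (longitude of `Kᵢ`), while the radius is
reversed when `n` is decreasing (the inside of the tube of `Lᵢ` is the far side of `Cᵢ`).
Pattern: the polar identification `polar`/`polarInv` of `CircleSurgeryExistence.lean`.

* `RadialSwapProfile` — the datum `(t₀, t₁, r₀, r₁, n, m)`: `n : (t₀, t₁) → (r₀, r₁)` and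
  `m : (r₀, r₁) → (t₀, t₁)` mutually inverse and `C^∞` there, `0 ≤ t₀`, `0 ≤ r₀`;
* `RadialSwapProfile.swapFun`, `invFun` — the two swaps; `shellSwap P : OpenPartialHomeomorph`
  of `𝕊 1 × ℝ²` with source the shell `(t₀, t₁)` and target the shell `(r₀, r₁)`;
* `contMDiffOn_shellSwap`, `contMDiffOn_shellSwap_symm` — `C^∞` in both directions;
* the bookkeeping lemmas `norm_swapFun_snd` (`= n ‖w‖`), `radialProjection_swapFun_snd`
  (`= u`), `swapFun_fst` (`= w/‖w‖`).

Everything here is proved; no named facts are introduced.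

## References

* S. Akbulut, D. Ruberman, *Absolutely exotic compact 4-manifolds*, Comment. Math. Helv. 91
  (2016), Lemma 2.3. [AkbulutRuberman2016]
* C. McA. Gordon, *Knots, homology spheres, and contractible 4-manifolds*, Topology 14 (1975),
  §3 (the tube swap). [Gordon1975]
-/

open scoped Manifold ContDiff Topology
open Set Function Metric

noncomputable section

namespace Literature.Topology.FourManifolds

/-- Local notation: `𝔼 n` is the model Euclidean space `EuclideanSpace ℝ (Fin n)`. -/
local notation "𝔼 " n:arg => EuclideanSpace ℝ (Fin n)

/-- Local notation: `𝕊 n` is the unit sphere in `EuclideanSpace ℝ (Fin (n + 1))`. -/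
local notation "𝕊 " n:arg => (Metric.sphere (0 : EuclideanSpace ℝ (Fin (n + 1))) 1)

attribute [local instance] fact_finrank_euclideanSpace_succ

/-! ### Radial profiles -/

/-- **A radial swap profile**: two open intervals `(t₀, t₁)`, `(r₀, r₁)` of nonnegative reals and
mutually inverse `C^∞` maps `n : (t₀, t₁) → (r₀, r₁)`, `m : (r₀, r₁) → (t₀, t₁)` (as functions
on `ℝ`; only their values on the intervals matter). [folklore] -/
structure RadialSwapProfile where
  /-- inner radius of the source shell -/
  t₀ : ℝ
  /-- outer radius of the source shell -/
  t₁ : ℝ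
  /-- inner radius of the target shell -/
  r₀ : ℝ
  /-- outer radius of the target shell -/
  r₁ : ℝ
  /-- the radial reparametrisation -/
  n : ℝ → ℝ
  /-- its inverse -/
  m : ℝ → ℝ
  t₀_nonneg : 0 ≤ t₀
  r₀_nonneg : 0 ≤ r₀
  n_mem : ∀ t ∈ Ioo t₀ t₁, n t ∈ Ioo r₀ r₁
  m_mem : ∀ r ∈ Ioo r₀ r₁, m r ∈ Ioo t₀ t₁
  m_n : ∀ t ∈ Ioo t₀ t₁, m (n t) = t
  n_m : ∀ r ∈ Ioo r₀ r₁, n (m r) = r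
  contDiffOn_n : ContDiffOn ℝ ∞ n (Ioo t₀ t₁)
  contDiffOn_m : ContDiffOn ℝ ∞ m (Ioo r₀ r₁)

namespace RadialSwapProfile

variable (P : RadialSwapProfile)

/-- **The reversed profile** (`m` and `n` exchanged): the profile of the inverse swap.
[folklore] -/
def symm : RadialSwapProfile where
  t₀ := P.r₀
  t₁ := P.r₁
  r₀ := P.t₀
  r₁ := P.t₁
  n := P.m
  m := P.n
  t₀_nonneg := P.r₀_nonneg
  r₀_nonneg := P.t₀_nonneg
  n_mem := P.m_mem
  m_mem := P.n_mem
  m_n := P.n_m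
  n_m := P.m_n
  contDiffOn_n := P.contDiffOn_m
  contDiffOn_m := P.contDiffOn_n

/-- `n` is positive on the source interval. [folklore] -/
theorem n_pos {t : ℝ} (ht : t ∈ Ioo P.t₀ P.t₁) : 0 < P.n t :=
  P.r₀_nonneg.trans_lt (P.n_mem t ht).1

/-- Points of the source interval are positive. [folklore] -/
theorem pos_of_mem {t : ℝ} (ht : t ∈ Ioo P.t₀ P.t₁) : 0 < t := P.t₀_nonneg.trans_lt ht.1

/-! ### The swap maps -/

/-- **The source shell** `{(u, w) ∣ t₀ < ‖w‖ < t₁}` of the open solid torus `𝕊 1 × ℝ²`.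
[folklore] -/
def shell : Set ((𝕊 1) × 𝔼 2) := {q | ‖q.2‖ ∈ Ioo P.t₀ P.t₁}

/-- Membership in the source shell. [folklore] -/
@[simp] theorem mem_shell_iff (q : (𝕊 1) × 𝔼 2) : q ∈ P.shell ↔ ‖q.2‖ ∈ Ioo P.t₀ P.t₁ := Iff.rfl

/-- The source shell is open. [folklore] -/
theorem isOpen_shell : IsOpen P.shell :=
  isOpen_Ioo.preimage (continuous_norm.comp continuous_snd)

/-- The target shell is the source shell of the reversed profile (definitional). [folklore] -/
theorem symm_shell : P.symm.shell = {q : (𝕊 1) × 𝔼 2 | ‖q.2‖ ∈ Ioo P.r₀ P.r₁} := rfl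

/-- Points of the shell have nonzero disc coordinate. [folklore] -/
theorem snd_ne_zero_of_mem_shell {q : (𝕊 1) × 𝔼 2} (hq : q ∈ P.shell) : q.2 ≠ 0 :=
  norm_pos_iff.1 (P.pos_of_mem hq)

/-- **The shell swap** `(u, w) ↦ (w/‖w‖, n(‖w‖) • u)` (junk direction at `w = 0`).
[cite: AkbulutRuberman2016, Lemma 2.3 ("glue the longitudes … to the respective meridian … and vice versa")] -/
def swapFun (q : (𝕊 1) × 𝔼 2) : (𝕊 1) × 𝔼 2 :=
  (radialProjection (spherePt 1) q.2, P.n ‖q.2‖ • (q.1 : 𝔼 2))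

/-- The first component of the swap is the direction of the disc coordinate. [folklore] -/
@[simp] theorem swapFun_fst (q : (𝕊 1) × 𝔼 2) :
    (P.swapFun q).1 = radialProjection (spherePt 1) q.2 := rfl

/-- The second component of the swap is `n(‖w‖) • u`. [folklore] -/
@[simp] theorem swapFun_snd (q : (𝕊 1) × 𝔼 2) :
    (P.swapFun q).2 = P.n ‖q.2‖ • (q.1 : 𝔼 2) := rfl

/-- On the shell the new disc coordinate has norm `n(‖w‖)`. [folklore] -/
theorem norm_swapFun_snd {q : (𝕊 1) × 𝔼 2} (hq : q ∈ P.shell) : ‖(P.swapFun q).2‖ = P.n ‖q.2‖ := by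
  rw [swapFun_snd, norm_smul_coe_sphere (P.n_pos hq).le]

/-- On the shell the direction of the new disc coordinate is `u`. [folklore] -/
theorem radialProjection_swapFun_snd {q : (𝕊 1) × 𝔼 2} (hq : q ∈ P.shell) (p : 𝕊 1) :
    radialProjection p (P.swapFun q).2 = q.1 := by
  rw [swapFun_snd, radialProjection_smul _ (P.n_pos hq)]

/-- The swap maps the source shell into the target shell. [folklore] -/
theorem swapFun_mem {q : (𝕊 1) × 𝔼 2} (hq : q ∈ P.shell) : P.swapFun q ∈ P.symm.shell := by
  show ‖(P.swapFun q).2‖ ∈ Ioo P.r₀ P.r₁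
  rw [P.norm_swapFun_snd hq]
  exact P.n_mem _ hq

/-- **The swap of the reversed profile inverts the swap** on the source shell. [folklore] -/
theorem symm_swapFun_swapFun {q : (𝕊 1) × 𝔼 2} (hq : q ∈ P.shell) :
    P.symm.swapFun (P.swapFun q) = q := by
  obtain ⟨u, w⟩ := q
  have hw : w ≠ 0 := P.snd_ne_zero_of_mem_shell hq
  have hn : 0 < P.n ‖w‖ := P.n_pos hq
  refine Prod.ext ?_ ?_
  · show radialProjection (spherePt 1) (P.n ‖w‖ • (u : 𝔼 2)) = u
    exact radialProjection_smul _ hn u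
  · show P.m ‖P.n ‖w‖ • (u : 𝔼 2)‖ • ((radialProjection (spherePt 1) w : 𝕊 1) : 𝔼 2) = w
    rw [norm_smul_coe_sphere hn.le, P.m_n _ hq, norm_smul_coe_radialProjection]

/-- The swap inverts the swap of the reversed profile on the target shell. [folklore] -/
theorem swapFun_symm_swapFun {q : (𝕊 1) × 𝔼 2} (hq : q ∈ P.symm.shell) :
    P.swapFun (P.symm.swapFun q) = q :=
  P.symm.symm_swapFun_swapFun hq

/-- **Smoothness of the swap on the shell** (the norm is smooth off `0`, the profile on the
interval, the radial projection off `0`, and the inclusion of the circle in the plane).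
[folklore] -/
theorem contMDiffOn_swapFun :
    ContMDiffOn ((𝓡 1).prod 𝓘(ℝ, 𝔼 2)) ((𝓡 1).prod 𝓘(ℝ, 𝔼 2)) ∞ P.swapFun P.shell := by
  refine ContMDiffOn.prodMk ?_ ?_
  · refine (contMDiffOn_radialProjection _).comp contMDiff_snd.contMDiffOn fun q hq => ?_
    exact P.snd_ne_zero_of_mem_shell hq
  · intro q hq
    have hq0 : q.2 ≠ 0 := P.snd_ne_zero_of_mem_shell hq
    have h1 : ContMDiffAt ((𝓡 1).prod 𝓘(ℝ, 𝔼 2)) 𝓘(ℝ, ℝ) ∞ (fun q : (𝕊 1) × 𝔼 2 => ‖q.2‖) q :=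
      (contDiffAt_norm ℝ hq0).comp_contMDiffAt contMDiffAt_snd
    have h2 : ContMDiffAt ((𝓡 1).prod 𝓘(ℝ, 𝔼 2)) 𝓘(ℝ, ℝ) ∞ (fun q : (𝕊 1) × 𝔼 2 => P.n ‖q.2‖) q :=
      ContDiffAt.comp_contMDiffAt (g := P.n) (f := fun q : (𝕊 1) × 𝔼 2 => ‖q.2‖) (x := q)
        (P.contDiffOn_n.contDiffAt (isOpen_Ioo.mem_nhds hq)) h1
    have h3 : ContMDiffAt ((𝓡 1).prod 𝓘(ℝ, 𝔼 2)) 𝓘(ℝ, 𝔼 2) ∞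
        (fun q : (𝕊 1) × 𝔼 2 => ((q.1 : 𝕊 1) : 𝔼 2)) q :=
      (contMDiff_coe_sphere (E := 𝔼 2) (n := 1)).contMDiffAt.comp q contMDiffAt_fst
    exact ((contDiff_fst (E := ℝ) (F := 𝔼 2).smul contDiff_snd).contDiffAt.comp_contMDiffAt
      (h2.prodMk_space h3)).contMDiffWithinAt

/-! ### The shell swap as a partial diffeomorphism -/

/-- **The shell swap as an open partial homeomorphism** of the open solid torus, source the
shell `(t₀, t₁)`, target the shell `(r₀, r₁)`, inverse the swap of the reversed profile.
[cite: AkbulutRuberman2016, Lemma 2.3] -/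
def shellSwap : OpenPartialHomeomorph ((𝕊 1) × 𝔼 2) ((𝕊 1) × 𝔼 2) where
  toFun := P.swapFun
  invFun := P.symm.swapFun
  source := P.shell
  target := P.symm.shell
  map_source' := fun _ hq => P.swapFun_mem hq
  map_target' := fun _ hq => P.symm.swapFun_mem hq
  left_inv' := fun _ hq => P.symm_swapFun_swapFun hq
  right_inv' := fun _ hq => P.swapFun_symm_swapFun hq
  open_source := P.isOpen_shell
  open_target := P.symm.isOpen_shell
  continuousOn_toFun := P.contMDiffOn_swapFun.continuousOn
  continuousOn_invFun := P.symm.contMDiffOn_swapFun.continuousOn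

/-- The shell swap as a function (definitional). [folklore] -/
@[simp] theorem shellSwap_apply (q : (𝕊 1) × 𝔼 2) : P.shellSwap q = P.swapFun q := rfl

/-- The inverse shell swap as a function (definitional). [folklore] -/
@[simp] theorem shellSwap_symm_apply (q : (𝕊 1) × 𝔼 2) : P.shellSwap.symm q = P.symm.swapFun q :=
  rfl

/-- The source of the shell swap (definitional). [folklore] -/
@[simp] theorem shellSwap_source : P.shellSwap.source = P.shell := rfl

/-- The target of the shell swap (definitional). [folklore] -/
@[simp] theorem shellSwap_target : P.shellSwap.target = P.symm.shell := rfl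

/-- The shell swap of the reversed profile is the inverse shell swap. [folklore] -/
theorem shellSwap_symm : P.shellSwap.symm = P.symm.shellSwap := rfl

/-- **The shell swap is `C^∞` on its source.** [folklore] -/
theorem contMDiffOn_shellSwap :
    ContMDiffOn ((𝓡 1).prod 𝓘(ℝ, 𝔼 2)) ((𝓡 1).prod 𝓘(ℝ, 𝔼 2)) ∞ P.shellSwap P.shellSwap.source :=
  P.contMDiffOn_swapFun

/-- **The inverse shell swap is `C^∞` on its source (the target).** [folklore] -/
theorem contMDiffOn_shellSwap_symm :
    ContMDiffOn ((𝓡 1).prod 𝓘(ℝ, 𝔼 2)) ((𝓡 1).prod 𝓘(ℝ, 𝔼 2)) ∞ P.shellSwap.symm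
      P.shellSwap.target :=
  P.symm.contMDiffOn_swapFun

end RadialSwapProfile

end Literature.Topology.FourManifolds

end
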